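import Mathlib
import Mathlib.MeasureTheory.Constructions.Pi
import Mathlib.MeasureTheory.Integral.Prod
import Mathlib.MeasureTheory.Measure.Lebesgue.VolumeOfBalls
import Mathlib.MeasureTheory.Measure.Lebesgue.Complex
import Literature.NumberTheory.Transcendental.KZCalculus
import HarnessLib.Audit
import Literature.NumberTheory.Transcendental.KZProduct
import HarnessLib

/-!
# PiCancellation — CONJECTURE (obligation of KontsevichZagierPeriods/KontsevichZagierPeriods)

Unproven conjecture migrated by the gate from `Literature/NumberTheory/Transcendental/KZProduct.lean` (`Literature.NumberTheory.Transcendental.KZ.PiCancellation`): unproven conjectures are obligations of our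
theories, not literature facts (human ruling 2026-08-15). Provenance: see docstring. Routes use it as a crux item or via
`--conditional-bridge --conditional-on PiCancellation`; a proof goes in the sibling `Theorems/PiCancellationHolds.lean` as `theorem PiCancellation_holds : PiCancellation` so this file stays a conjecture LEAF that Literature/ may import.
-/

namespace Summit.KontsevichZagierPeriods.KontsevichZagierPeriods

open Literature Literature.NumberTheory Literature.NumberTheory.Transcendental Literature.NumberTheory.Transcendental.KZ
open MeasureTheory MvPolynomial Set

/-- OPEN CONJECTURE — **`π`-cancellation** for the Kontsevich–Zagier calculus, a ROUTE STATEMENT,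
not a published result: if `[π] * c` is a relation then so is `c`, i.e. `[π] = [{x² + y² ≤ 1}, 1]`
is a non-zero-divisor on the formal effective period ring `FormalRep ⧸ relations` (equivalently
the endomorphism `piMulQuot` induced by `[π] * ·` is injective: `piCancellation_iff_injective` in
`KZProductIdeal.lean`). POSED, for this calculus, by route KontsevichZagierPeriods/
AyoubSpecialisation as its crux stmt-KontsevichZagierPeriods-0540 (second conjunct of the thesis
stmt-KontsevichZagierPeriods-0538; the negation `¬ PiCancellation` is item
stmt-KontsevichZagierPeriods-0542) and stated nowhere in print (five groundings, a refuter check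
and the reground of 2026-08-14 recorded on item 0540). Its motivic shadow — injectivity of the
localisation map from formal EFFECTIVE periods to formal periods with `2πi` inverted — is printed
as an OPEN QUESTION: Huber–Wüstholz, *Transcendence and Linear Relations of 1-Periods* (2022),
App. A.4, paragraph after Cor. A.11: "`P(MM_Nori(ℚ̄, ℚ)) = P^eff[1/2πi]` because `2πi` is the period
of `ℚ(-1)`. As we do not know if `MM^eff_Nori(ℚ̄, ℚ) → MM_Nori(ℚ̄, ℚ)` is full, it is also an open
question whether `P̃(MM^eff_Nori(ℚ̄, ℚ)) → P̃(MM_Nori(ℚ̄, ℚ))` is injective. By Proposition 7.17, this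
injectivity is a consequence of the Period Conjecture for `MM_Nori(ℚ̄, ℚ)`. We deduce it for the
category `d₁MM_Nori(ℚ̄, ℚ)` in Theorem 13.5" (and App. A.3, after Def. A.9: the functor
`MM^eff_Nori → MM_Nori` "is faithful … However, we do not know if it is full"); the same
effective-versus-localised seam is Ayoub's erratum note *La version relative de la conjecture des
périodes de Kontsevich–Zagier revisitée* (2015), Rem. 1.3: the relative period theorem is proved
only where `2πi` is invertible ("cette condition entraîne que l'élément `2πi ∈ P(k)` est
inversible. On peut alors utiliser le fait que, au-dessus de l'ouvert `Spec(P(k, σ)) = D(2πi⁻¹) ⊂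
Spec(P^eff(k, σ))`, [the spectrum of the relative effective period algebra] est un torseur … pour
conclure"; "On ignore si [5, Théorèmes 3.27 et 4.25] sont vrais sans l'hypothèse que `π ∈ ℂ` est
algébrique sur `k`"). The element comes from
Kontsevich–Zagier's extended algebra `P̂ = P[(2πi)⁻¹]` (*Periods*, 2001, §4.1, p. 31). Status in
the tree: a consequence of the kernel conjecture `KZKernelConjecture` given soundness of the moves
(`piCancellation_of_kernel` below: `eval ([π] * c) = π · eval c` and `π ≠ 0`), so a counterexample
would refute `KZKernelConjecture`; together with `PiLocalKernel` it implies `KZKernelConjecture`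
(`Summits/KontsevichZagierPeriods/KontsevichZagierPeriods/Theorems/AyoubSpecialisationAssembly.lean`);
neither proved nor refuted. Registered as an open statement (CONVENTIONS §4: open conjectures
stay `def … : Prop`), not a named fact: there is no source to discharge it from and no `_holds`
theorem is expected from the literature (settling it is the business of items 0540 / 0542); the
name is kept (users: `piCancellation_of_kernel`, `piLocalKernel_and_piCancellation_of_kernel`,
`KZProductIdeal.lean`'s `piCancellation_iff_injective`, and items 0538/0540/0542 of the route
file `Summits/KontsevichZagierPeriods/KontsevichZagierPeriods/Theses/AyoubSpecialisation.lean`).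
Provenance: no single source (context Kontsevich–Zagier 2001, §4.1; Huber–Wüstholz 2022,
App. A). [folklore] [status: open] -/
@[conjecture] def PiCancellation : Prop :=
  ∀ c : FormalRep, of piRep * c ∈ relations → c ∈ relations

end Summit.KontsevichZagierPeriods.KontsevichZagierPeriods
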